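import Literature.NumberTheory.Automorphic.UnitOrbitalIntegralFixedPointsVolume     -- ★ generic `classOrbitalIntegral_smul_indicator_complex_eq_natCard_fixedBy`, ★ `…_local_eq_natCard_fixedBy` on `U(H)(L⁺_v)`
import Literature.NumberTheory.Automorphic.UnitOrbitalIntegralFixedPointsPair       -- ★ `natCard_fixedBy_quotient_prod_of_eq_top`, `compactSpace_centralizer_prod`, `compactSpace_cmDatum_local_one_of_smul_eq`
import Literature.NumberTheory.Automorphic.LocalEndoscopicOrbitClosed               -- ★ `isClosed_conjClass_localH_of_isLocalGRegular`
import Literature.NumberTheory.Rogawski1990.GRegularLocalisation                    -- ★ `isLocalGRegular_of_isConj`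
import Literature.NumberTheory.Rogawski1990.LocalCentralizerTorusMeasureCM          -- ★ `isRegularElt_fst_snd_of_isLocalGRegular`
import HarnessLib

/-!
# F0 · P3c · line LH6 «StCharTS» — road «M5-H» (LEAD F0P3a-plan (g15) T14-41), brick (B2a) «H-ORB-ELL»: at a `G`-regular class of
# `H_v = U(Φ₂)(L⁺_v) × U(Φ₁)(L⁺_v)` with COMPACT centraliser, the volume-normalised orbital integral of a product level `C × U(Φ₁)(L⁺_v)` is the
# fixed-point count of the `U(Φ₂)`-component on `U(Φ₂)(L⁺_v) ⧸ C` — hence equals the `U(Φ₂)(L⁺_v)`-side volume-normalised orbital integral of `𝟙_C`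
# [Kottwitz1988, §2 Thm. 2 (elliptic case); Laumon1996, (5.3.2); Rogawski1990, §4.9 p. 54, §12.5 p. 184]

Cell `pub/hodgecm-mathlib`, crux H413 = `stmt-HodgeConjecture-24833` (lane `--supports … --as helper`), route HCCMUnconditional; seat F0P3a-p04 (g29), ROAD «M5-H» holder
(census `F0/P3a/F0P3a-p04/g29/m5h/CENSUS-M5H.v1`, LEAD T14-41 fences (α)–(ε)).  THEOREMS ONLY (no definition ∕ instance ∕ notation ∕ named fact ∕ `sorry`); ★-only imports.

WHY (fence (β) of T14-41: «an `H`-side EP identity that is NOT ★ is a new brick»).  Kottwitz's Euler–Poincaré function is ★ on `U₂ = U(Φ₂)(L⁺_v)` (★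
`rankOneEulerPoincareNonsplit_holds`, relations (E)∕(N) by name in (B1) `exists_epRelations_nonsplit`); the Weyl integration formula the road uses is on `H_v = U₂ × U₁` (★ (H5‴)).
The bridge is the identity, for `C ≤ U₂` compact open and `C⋆ := C.prod ⊤ ≤ H_v`,
  `νHv(C⋆)⁻¹ · Φ_H(⟦γ_H⟧, 𝟙_{C⋆}; mHv) = #Fix_{γ_H.1}(U₂ ⧸ C) = ν₂(C)⁻¹ · Φ_{U₂}(⟦γ_H.1⟧, 𝟙_C; m₂)`
for canonical families `mHv` (for `IsLocalGRegular`, `νHv`) and `m₂` (for `IsRegularElt`, `ν₂`) and ANY Haar measures `νHv`, `ν₂`.  THIS FILE: the COMPACT-centraliser case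
(elliptic `γ_H`); both sides are fixed-point counts (★ generic class reading `classOrbitalIntegral_smul_indicator_complex_eq_natCard_fixedBy` on `H_v`, ★ its `U(H)(L⁺_v)` dress on `U₂`),
and `#Fix_{γ_H}(H_v ⧸ C⋆) = #Fix_{γ_H.1}(U₂ ⧸ C)` (★ `natCard_fixedBy_quotient_prod_of_eq_top`).  The non-compact case (per-period counts) is (B2b).

* §1 `isCompact_isOpen_coe_prod_top` — `C⋆` is compact open (`U(Φ₁)(L⁺_v)` is compact at a non-split `v`, ★ `compactSpace_cmDatum_local_one_of_smul_eq`);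
  `compactSpace_centralizerH_of_fst` — `Z_H(γ_H)` is compact when `Z_{U₂}(γ_H.1)` is; `compactSpace_centralizer_fst_of_centralizerH` — and conversely.
* §2 `classOrbitalIntegral_smul_indicator_prod_top_eq_natCard_fixedBy` — **(E_H) reading**: `Φ_H(⟦γ_H⟧, νHv(C⋆)⁻¹ 𝟙_{C⋆}) = #Fix_{γ_H.1}(U₂ ⧸ C)`;
  `classOrbitalIntegral_smul_indicator_prod_top_eq_U2` — **`= Φ_{U₂}(⟦γ_H.1⟧, ν₂(C)⁻¹ 𝟙_C)`** for any canonical `m₂` on `U₂`.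
HONEST LABEL: count-neutral helper of «M5-H»; (M5) stays a PRINTED block consequent until its ★ rider; HC_CM is proved only modulo the 7 printed citations (2 remaining named inputs:
hLiu418 = `stmt-HodgeConjecture-24832`, h413 = `stmt-HodgeConjecture-24833`) until rung 0 closes.

## References
* [Kottwitz1988] R. E. Kottwitz, *Tamagawa numbers*, Ann. of Math. 127 (1988), 629–646, §2 Theorem 2.
* [Laumon1995] G. Laumon, *Cohomology of Drinfeld Modular Varieties* I (1996), Lemma (5.3.2) p. 136.
* [Rogawski1990] J. D. Rogawski, *Automorphic Representations of Unitary Groups in Three Variables*, Ann. of Math. Stud. 123 (1990): §4.3 (4.3.1) p. 43; §4.9 p. 54;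
  §12.5 p. 184; §12.6 p. 187.
-/

set_option autoImplicit false
-- the mandated namespace has the single-problem summit's repeated segment (`HodgeConjecture.HodgeConjecture`)
set_option linter.dupNamespace false

noncomputable section

open NumberField IsDedekindDomain MeasureTheory Measure Topology Set
open scoped Matrix MatrixGroups ENNReal
open Literature.NumberTheory.Rogawski1990 Literature.NumberTheory.Automorphic Literature.NumberTheory.Automorphic.UnitaryGroup

namespace Summit.HodgeConjecture.HodgeConjecture.Cruxes.H413.F0P3cStCharTSEllMassHOrbEll

section CM

variable (L : Type) [Field L] [NumberField L] [IsCMField L] (v : HeightOneSpectrum (𝓞 ↥(maximalRealSubfield L)))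

/-! ## §1 Product levels and product centralisers -/

/-- **`C⋆ = C × U(Φ₁)(L⁺_v)` is compact open** when `C ≤ U(Φ₂)(L⁺_v)` is (at a non-split `v`, `U(Φ₁)(L⁺_v) = E¹_w` is compact: ★ `compactSpace_cmDatum_local_one_of_smul_eq`).
[cite: Rogawski1990, §4.9 p. 54] [cite: Kottwitz1988, §2] -/
theorem isCompact_isOpen_coe_prod_top (hns : ∀ w : PlacesOver L v, IsCMField.complexConj L • w.1 = w.1)
    (C : Subgroup ((UnitaryGroup.cmDatum L 2 (Matrix.of fun i j : Fin 2 => if i.val + j.val + 1 = 2 then (1 : L) else 0)).Local v))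
    (hCo : IsOpen (C : Set ((UnitaryGroup.cmDatum L 2 (Matrix.of fun i j : Fin 2 => if i.val + j.val + 1 = 2 then (1 : L) else 0)).Local v)))
    (hCc : IsCompact (C : Set ((UnitaryGroup.cmDatum L 2 (Matrix.of fun i j : Fin 2 => if i.val + j.val + 1 = 2 then (1 : L) else 0)).Local v))) :
    IsCompact (((C.prod ⊤ : Subgroup ((UnitaryGroup.cmDatum L 2 (Matrix.of fun i j : Fin 2 => if i.val + j.val + 1 = 2 then (1 : L) else 0)).Local v ×
        (UnitaryGroup.cmDatum L 1 (Matrix.of fun i j : Fin 1 => if i.val + j.val + 1 = 1 then (1 : L) else 0)).Local v))) :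
      Set ((UnitaryGroup.cmDatum L 2 (Matrix.of fun i j : Fin 2 => if i.val + j.val + 1 = 2 then (1 : L) else 0)).Local v ×
        (UnitaryGroup.cmDatum L 1 (Matrix.of fun i j : Fin 1 => if i.val + j.val + 1 = 1 then (1 : L) else 0)).Local v)) ∧
    IsOpen (((C.prod ⊤ : Subgroup ((UnitaryGroup.cmDatum L 2 (Matrix.of fun i j : Fin 2 => if i.val + j.val + 1 = 2 then (1 : L) else 0)).Local v ×
        (UnitaryGroup.cmDatum L 1 (Matrix.of fun i j : Fin 1 => if i.val + j.val + 1 = 1 then (1 : L) else 0)).Local v))) :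
      Set ((UnitaryGroup.cmDatum L 2 (Matrix.of fun i j : Fin 2 => if i.val + j.val + 1 = 2 then (1 : L) else 0)).Local v ×
        (UnitaryGroup.cmDatum L 1 (Matrix.of fun i j : Fin 1 => if i.val + j.val + 1 = 1 then (1 : L) else 0)).Local v)) := by
  obtain ⟨w⟩ : Nonempty (PlacesOver L v) := inferInstance
  haveI : CompactSpace ((UnitaryGroup.cmDatum L 1 (Matrix.of fun i j : Fin 1 => if i.val + j.val + 1 = 1 then (1 : L) else 0)).Local v) :=
    compactSpace_cmDatum_local_one_of_smul_eq L (Matrix.of fun i j : Fin 1 => if i.val + j.val + 1 = 1 then (1 : L) else 0) w (hns w)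
      (isUnit_placeForm_antidiagOne (E := L) 1 w.1)
  rw [Subgroup.coe_prod, Subgroup.coe_top]
  exact ⟨hCc.prod isCompact_univ, hCo.prod isOpen_univ⟩

/-- **`Z_H(γ_H)` is compact when `Z_{U₂}(γ_H.1)` is** (`Z_H((a, b)) = Z(a) × Z(b)` ★ `centralizer_prod_singleton`; `Z(b) ≤ U(Φ₁)(L⁺_v)` compact at non-split `v`).
[cite: Rogawski1990, §12.5 p. 184] -/
theorem compactSpace_centralizerH_of_fst (hns : ∀ w : PlacesOver L v, IsCMField.complexConj L • w.1 = w.1)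
    (γH : (UnitaryGroup.cmDatum L 2 (Matrix.of fun i j : Fin 2 => if i.val + j.val + 1 = 2 then (1 : L) else 0)).Local v ×
      (UnitaryGroup.cmDatum L 1 (Matrix.of fun i j : Fin 1 => if i.val + j.val + 1 = 1 then (1 : L) else 0)).Local v)
    [CompactSpace (Subgroup.centralizer ({γH.1} : Set ((UnitaryGroup.cmDatum L 2 (Matrix.of fun i j : Fin 2 => if i.val + j.val + 1 = 2 then (1 : L) else 0)).Local v)))] :
    CompactSpace (Subgroup.centralizer ({γH} : Set ((UnitaryGroup.cmDatum L 2 (Matrix.of fun i j : Fin 2 => if i.val + j.val + 1 = 2 then (1 : L) else 0)).Local v ×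
      (UnitaryGroup.cmDatum L 1 (Matrix.of fun i j : Fin 1 => if i.val + j.val + 1 = 1 then (1 : L) else 0)).Local v))) := by
  obtain ⟨w⟩ : Nonempty (PlacesOver L v) := inferInstance
  haveI : CompactSpace ((UnitaryGroup.cmDatum L 1 (Matrix.of fun i j : Fin 1 => if i.val + j.val + 1 = 1 then (1 : L) else 0)).Local v) :=
    compactSpace_cmDatum_local_one_of_smul_eq L (Matrix.of fun i j : Fin 1 => if i.val + j.val + 1 = 1 then (1 : L) else 0) w (hns w)
      (isUnit_placeForm_antidiagOne (E := L) 1 w.1)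
  haveI : CompactSpace (Subgroup.centralizer ({γH.2} : Set ((UnitaryGroup.cmDatum L 1 (Matrix.of fun i j : Fin 1 => if i.val + j.val + 1 = 1 then (1 : L) else 0)).Local v))) :=
    isCompact_iff_compactSpace.1 (isClosed_coe_centralizer_singleton γH.2).isCompact
  exact compactSpace_centralizer_prod γH.1 γH.2

/-- **Conversely, `Z_{U₂}(γ_H.1)` is compact when `Z_H(γ_H)` is**: `Z(γ_H.1) × {1}` is a closed subset of the compact `Z_H(γ_H)` (as subsets of `H_v`).
[cite: Rogawski1990, §12.5 p. 184] -/
theorem compactSpace_centralizer_fst_of_centralizerH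
    (γH : (UnitaryGroup.cmDatum L 2 (Matrix.of fun i j : Fin 2 => if i.val + j.val + 1 = 2 then (1 : L) else 0)).Local v ×
      (UnitaryGroup.cmDatum L 1 (Matrix.of fun i j : Fin 1 => if i.val + j.val + 1 = 1 then (1 : L) else 0)).Local v)
    [hZ : CompactSpace (Subgroup.centralizer ({γH} : Set ((UnitaryGroup.cmDatum L 2 (Matrix.of fun i j : Fin 2 => if i.val + j.val + 1 = 2 then (1 : L) else 0)).Local v ×
      (UnitaryGroup.cmDatum L 1 (Matrix.of fun i j : Fin 1 => if i.val + j.val + 1 = 1 then (1 : L) else 0)).Local v)))] :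
    CompactSpace (Subgroup.centralizer ({γH.1} : Set ((UnitaryGroup.cmDatum L 2 (Matrix.of fun i j : Fin 2 => if i.val + j.val + 1 = 2 then (1 : L) else 0)).Local v))) := by
  -- `Z(γ_H.1)` is the continuous image of `Z_H(γ_H)` under the first projection
  have hZc : IsCompact ((Subgroup.centralizer ({γH} : Set ((UnitaryGroup.cmDatum L 2 (Matrix.of fun i j : Fin 2 => if i.val + j.val + 1 = 2 then (1 : L) else 0)).Local v ×
      (UnitaryGroup.cmDatum L 1 (Matrix.of fun i j : Fin 1 => if i.val + j.val + 1 = 1 then (1 : L) else 0)).Local v)) : Subgroup ((UnitaryGroup.cmDatum L 2 (Matrix.of fun i j : Fin 2 => if i.val + j.val + 1 = 2 then (1 : L) else 0)).Local v ×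
      (UnitaryGroup.cmDatum L 1 (Matrix.of fun i j : Fin 1 => if i.val + j.val + 1 = 1 then (1 : L) else 0)).Local v)) : Set ((UnitaryGroup.cmDatum L 2 (Matrix.of fun i j : Fin 2 => if i.val + j.val + 1 = 2 then (1 : L) else 0)).Local v ×
      (UnitaryGroup.cmDatum L 1 (Matrix.of fun i j : Fin 1 => if i.val + j.val + 1 = 1 then (1 : L) else 0)).Local v)) := isCompact_iff_compactSpace.2 (by exact hZ)
  have himage : ((Subgroup.centralizer ({γH.1} : Set ((UnitaryGroup.cmDatum L 2 (Matrix.of fun i j : Fin 2 => if i.val + j.val + 1 = 2 then (1 : L) else 0)).Local v)) :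
      Subgroup ((UnitaryGroup.cmDatum L 2 (Matrix.of fun i j : Fin 2 => if i.val + j.val + 1 = 2 then (1 : L) else 0)).Local v)) :
      Set ((UnitaryGroup.cmDatum L 2 (Matrix.of fun i j : Fin 2 => if i.val + j.val + 1 = 2 then (1 : L) else 0)).Local v)) =
      Prod.fst '' ((Subgroup.centralizer ({γH} : Set ((UnitaryGroup.cmDatum L 2 (Matrix.of fun i j : Fin 2 => if i.val + j.val + 1 = 2 then (1 : L) else 0)).Local v ×
      (UnitaryGroup.cmDatum L 1 (Matrix.of fun i j : Fin 1 => if i.val + j.val + 1 = 1 then (1 : L) else 0)).Local v)) : Subgroup ((UnitaryGroup.cmDatum L 2 (Matrix.of fun i j : Fin 2 => if i.val + j.val + 1 = 2 then (1 : L) else 0)).Local v ×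
      (UnitaryGroup.cmDatum L 1 (Matrix.of fun i j : Fin 1 => if i.val + j.val + 1 = 1 then (1 : L) else 0)).Local v)) : Set ((UnitaryGroup.cmDatum L 2 (Matrix.of fun i j : Fin 2 => if i.val + j.val + 1 = 2 then (1 : L) else 0)).Local v ×
      (UnitaryGroup.cmDatum L 1 (Matrix.of fun i j : Fin 1 => if i.val + j.val + 1 = 1 then (1 : L) else 0)).Local v)) := by
    ext x
    simp only [SetLike.mem_coe, Subgroup.mem_centralizer_singleton_iff, Set.mem_image, Prod.exists]
    constructor
    · intro hx
      refine ⟨x, 1, ?_, rfl⟩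
      exact Prod.ext (by simpa using hx) (by simp)
    · rintro ⟨a, b, hab, rfl⟩
      simpa using congrArg Prod.fst hab
  exact isCompact_iff_compactSpace.1 (himage ▸ hZc.image continuous_fst)

/-! ## §2 The (E_H) reading: volume-normalised orbital integrals of product levels at an elliptic `G`-regular class -/

variable
  [MeasurableSpace ((UnitaryGroup.cmDatum L 2 (Matrix.of fun i j : Fin 2 => if i.val + j.val + 1 = 2 then (1 : L) else 0)).Local v ×
      (UnitaryGroup.cmDatum L 1 (Matrix.of fun i j : Fin 1 => if i.val + j.val + 1 = 1 then (1 : L) else 0)).Local v)]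
  [BorelSpace ((UnitaryGroup.cmDatum L 2 (Matrix.of fun i j : Fin 2 => if i.val + j.val + 1 = 2 then (1 : L) else 0)).Local v ×
      (UnitaryGroup.cmDatum L 1 (Matrix.of fun i j : Fin 1 => if i.val + j.val + 1 = 1 then (1 : L) else 0)).Local v)]
  [∀ a : (UnitaryGroup.cmDatum L 2 (Matrix.of fun i j : Fin 2 => if i.val + j.val + 1 = 2 then (1 : L) else 0)).Local v ×
      (UnitaryGroup.cmDatum L 1 (Matrix.of fun i j : Fin 1 => if i.val + j.val + 1 = 1 then (1 : L) else 0)).Local v,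
    MeasurableSpace (((UnitaryGroup.cmDatum L 2 (Matrix.of fun i j : Fin 2 => if i.val + j.val + 1 = 2 then (1 : L) else 0)).Local v ×
      (UnitaryGroup.cmDatum L 1 (Matrix.of fun i j : Fin 1 => if i.val + j.val + 1 = 1 then (1 : L) else 0)).Local v) ⧸
      Subgroup.centralizer ({a} : Set ((UnitaryGroup.cmDatum L 2 (Matrix.of fun i j : Fin 2 => if i.val + j.val + 1 = 2 then (1 : L) else 0)).Local v ×
      (UnitaryGroup.cmDatum L 1 (Matrix.of fun i j : Fin 1 => if i.val + j.val + 1 = 1 then (1 : L) else 0)).Local v)))]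
  [∀ a : (UnitaryGroup.cmDatum L 2 (Matrix.of fun i j : Fin 2 => if i.val + j.val + 1 = 2 then (1 : L) else 0)).Local v ×
      (UnitaryGroup.cmDatum L 1 (Matrix.of fun i j : Fin 1 => if i.val + j.val + 1 = 1 then (1 : L) else 0)).Local v,
    BorelSpace (((UnitaryGroup.cmDatum L 2 (Matrix.of fun i j : Fin 2 => if i.val + j.val + 1 = 2 then (1 : L) else 0)).Local v ×
      (UnitaryGroup.cmDatum L 1 (Matrix.of fun i j : Fin 1 => if i.val + j.val + 1 = 1 then (1 : L) else 0)).Local v) ⧸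
      Subgroup.centralizer ({a} : Set ((UnitaryGroup.cmDatum L 2 (Matrix.of fun i j : Fin 2 => if i.val + j.val + 1 = 2 then (1 : L) else 0)).Local v ×
      (UnitaryGroup.cmDatum L 1 (Matrix.of fun i j : Fin 1 => if i.val + j.val + 1 = 1 then (1 : L) else 0)).Local v)))]
  (νHv : Measure ((UnitaryGroup.cmDatum L 2 (Matrix.of fun i j : Fin 2 => if i.val + j.val + 1 = 2 then (1 : L) else 0)).Local v ×
      (UnitaryGroup.cmDatum L 1 (Matrix.of fun i j : Fin 1 => if i.val + j.val + 1 = 1 then (1 : L) else 0)).Local v)) [νHv.IsHaarMeasure] [νHv.IsMulRightInvariant]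

/-- **(E_H) READING: `Φ_H(⟦γ_H⟧, νHv(C⋆)⁻¹ · 𝟙_{C⋆}; mHv) = #Fix_{γ_H.1}(U₂ ⧸ C)`** for `mHv` canonical for (`IsLocalGRegular`, `νHv`), `γ_H` `G`-regular with `Z_{U₂}(γ_H.1)` compact,
`C ≤ U₂` compact open, `C⋆ = C.prod ⊤` — ★ generic `classOrbitalIntegral_smul_indicator_complex_eq_natCard_fixedBy` on `H_v` (class of `γ_H` closed: ★
`isClosed_conjClass_localH_of_isLocalGRegular`; `G`-regularity a class function: ★ `isLocalGRegular_of_isConj`) and ★ `natCard_fixedBy_quotient_prod_of_eq_top`.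
[cite: Kottwitz1988, §2 Theorem 2] [cite: Laumon1995, Lemma (5.3.2) p. 136] [cite: Rogawski1990, §4.9 p. 54; §4.3 (4.3.1) p. 43] -/
theorem classOrbitalIntegral_smul_indicator_prod_top_eq_natCard_fixedBy (hns : ∀ w : PlacesOver L v, IsCMField.complexConj L • w.1 = w.1)
    {mHv : OrbitalMeasureFamily ((UnitaryGroup.cmDatum L 2 (Matrix.of fun i j : Fin 2 => if i.val + j.val + 1 = 2 then (1 : L) else 0)).Local v ×
      (UnitaryGroup.cmDatum L 1 (Matrix.of fun i j : Fin 1 => if i.val + j.val + 1 = 1 then (1 : L) else 0)).Local v)}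
    (hcanH : mHv.IsCanonical (IsLocalGRegular L v) νHv)
    (C : Subgroup ((UnitaryGroup.cmDatum L 2 (Matrix.of fun i j : Fin 2 => if i.val + j.val + 1 = 2 then (1 : L) else 0)).Local v))
    (hCo : IsOpen (C : Set ((UnitaryGroup.cmDatum L 2 (Matrix.of fun i j : Fin 2 => if i.val + j.val + 1 = 2 then (1 : L) else 0)).Local v)))
    (hCc : IsCompact (C : Set ((UnitaryGroup.cmDatum L 2 (Matrix.of fun i j : Fin 2 => if i.val + j.val + 1 = 2 then (1 : L) else 0)).Local v)))
    (γH : (UnitaryGroup.cmDatum L 2 (Matrix.of fun i j : Fin 2 => if i.val + j.val + 1 = 2 then (1 : L) else 0)).Local v ×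
      (UnitaryGroup.cmDatum L 1 (Matrix.of fun i j : Fin 1 => if i.val + j.val + 1 = 1 then (1 : L) else 0)).Local v)
    (hγ : IsLocalGRegular L v γH)
    [CompactSpace (Subgroup.centralizer ({γH.1} : Set ((UnitaryGroup.cmDatum L 2 (Matrix.of fun i j : Fin 2 => if i.val + j.val + 1 = 2 then (1 : L) else 0)).Local v)))] :
    classOrbitalIntegral mHv
        (fun g => (((νHv ((C.prod ⊤ : Subgroup ((UnitaryGroup.cmDatum L 2 (Matrix.of fun i j : Fin 2 => if i.val + j.val + 1 = 2 then (1 : L) else 0)).Local v ×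
          (UnitaryGroup.cmDatum L 1 (Matrix.of fun i j : Fin 1 => if i.val + j.val + 1 = 1 then (1 : L) else 0)).Local v)))).toReal : ℂ))⁻¹ *
          (((C.prod ⊤ : Subgroup ((UnitaryGroup.cmDatum L 2 (Matrix.of fun i j : Fin 2 => if i.val + j.val + 1 = 2 then (1 : L) else 0)).Local v ×
            (UnitaryGroup.cmDatum L 1 (Matrix.of fun i j : Fin 1 => if i.val + j.val + 1 = 1 then (1 : L) else 0)).Local v))) : Set _).indicator (fun _ => (1 : ℂ)) g)
        (ConjClasses.mk γH) =
      (Nat.card (MulAction.fixedBy ((UnitaryGroup.cmDatum L 2 (Matrix.of fun i j : Fin 2 => if i.val + j.val + 1 = 2 then (1 : L) else 0)).Local v ⧸ C) γH.1) : ℂ) := by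
  haveI := compactSpace_centralizerH_of_fst L v hns γH
  have hCst := isCompact_isOpen_coe_prod_top L v hns C hCo hCc
  rw [classOrbitalIntegral_smul_indicator_complex_eq_natCard_fixedBy (P := IsLocalGRegular L v)
    (fun _ x hg => isLocalGRegular_of_isConj (isConj_iff.2 ⟨x, rfl⟩) hg) hcanH hγ _ hCst.2 hCst.1 (isClosed_conjClass_localH_of_isLocalGRegular L v γH hγ)]
  have h := natCard_fixedBy_quotient_prod_of_eq_top C (⊤ : Subgroup ((UnitaryGroup.cmDatum L 1 (Matrix.of fun i j : Fin 1 => if i.val + j.val + 1 = 1 then (1 : L) else 0)).Local v)) rfl γH.1 γH.2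
  exact_mod_cast h

/-- **`H_v`-side = `U₂`-side at an elliptic `G`-regular class: `Φ_H(⟦γ_H⟧, νHv(C⋆)⁻¹ 𝟙_{C⋆}; mHv) = Φ_{U₂}(⟦γ_H.1⟧, ν₂(C)⁻¹ 𝟙_C; m₂)`** for ANY Haar measures `νHv`, `ν₂` and
canonical families `mHv` (for `IsLocalGRegular`, `νHv`), `m₂` (for `IsRegularElt`, `ν₂`) — both sides are `#Fix_{γ_H.1}(U₂ ⧸ C)` (★ `classOrbitalIntegral_smul_indicator_complex_local_eq_natCard_fixedBy`
on `U₂`; `γ_H.1` is regular by ★ `isRegularElt_fst_snd_of_isLocalGRegular`).  The `H_v`-instance of the elliptic half of Kottwitz's theorem is thus READ OFF the `U₂`-instance.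
[cite: Kottwitz1988, §2 Theorem 2] [cite: Rogawski1990, §4.9 p. 54; §12.6 p. 187] [cite: Laumon1995, Lemma (5.3.2) p. 136] -/
theorem classOrbitalIntegral_smul_indicator_prod_top_eq_U2 (hns : ∀ w : PlacesOver L v, IsCMField.complexConj L • w.1 = w.1)
    {mHv : OrbitalMeasureFamily ((UnitaryGroup.cmDatum L 2 (Matrix.of fun i j : Fin 2 => if i.val + j.val + 1 = 2 then (1 : L) else 0)).Local v ×
      (UnitaryGroup.cmDatum L 1 (Matrix.of fun i j : Fin 1 => if i.val + j.val + 1 = 1 then (1 : L) else 0)).Local v)}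
    (hcanH : mHv.IsCanonical (IsLocalGRegular L v) νHv)
    [MeasurableSpace ((UnitaryGroup.cmDatum L 2 (Matrix.of fun i j : Fin 2 => if i.val + j.val + 1 = 2 then (1 : L) else 0)).Local v)]
    [BorelSpace ((UnitaryGroup.cmDatum L 2 (Matrix.of fun i j : Fin 2 => if i.val + j.val + 1 = 2 then (1 : L) else 0)).Local v)]
    [∀ γ : (UnitaryGroup.cmDatum L 2 (Matrix.of fun i j : Fin 2 => if i.val + j.val + 1 = 2 then (1 : L) else 0)).Local v,
      MeasurableSpace (((UnitaryGroup.cmDatum L 2 (Matrix.of fun i j : Fin 2 => if i.val + j.val + 1 = 2 then (1 : L) else 0)).Local v) ⧸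
        Subgroup.centralizer ({γ} : Set ((UnitaryGroup.cmDatum L 2 (Matrix.of fun i j : Fin 2 => if i.val + j.val + 1 = 2 then (1 : L) else 0)).Local v)))]
    [∀ γ : (UnitaryGroup.cmDatum L 2 (Matrix.of fun i j : Fin 2 => if i.val + j.val + 1 = 2 then (1 : L) else 0)).Local v,
      BorelSpace (((UnitaryGroup.cmDatum L 2 (Matrix.of fun i j : Fin 2 => if i.val + j.val + 1 = 2 then (1 : L) else 0)).Local v) ⧸
        Subgroup.centralizer ({γ} : Set ((UnitaryGroup.cmDatum L 2 (Matrix.of fun i j : Fin 2 => if i.val + j.val + 1 = 2 then (1 : L) else 0)).Local v)))]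
    (ν₂ : Measure ((UnitaryGroup.cmDatum L 2 (Matrix.of fun i j : Fin 2 => if i.val + j.val + 1 = 2 then (1 : L) else 0)).Local v)) [ν₂.IsHaarMeasure] [ν₂.IsMulRightInvariant]
    {m₂ : OrbitalMeasureFamily ((UnitaryGroup.cmDatum L 2 (Matrix.of fun i j : Fin 2 => if i.val + j.val + 1 = 2 then (1 : L) else 0)).Local v)}
    (hcan₂ : m₂.IsCanonical (fun γ => IsRegularElt (γ.val : GL (Fin 2) (UnitaryGroup.LocalRing L v))) ν₂)
    (C : Subgroup ((UnitaryGroup.cmDatum L 2 (Matrix.of fun i j : Fin 2 => if i.val + j.val + 1 = 2 then (1 : L) else 0)).Local v))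
    (hCo : IsOpen (C : Set ((UnitaryGroup.cmDatum L 2 (Matrix.of fun i j : Fin 2 => if i.val + j.val + 1 = 2 then (1 : L) else 0)).Local v)))
    (hCc : IsCompact (C : Set ((UnitaryGroup.cmDatum L 2 (Matrix.of fun i j : Fin 2 => if i.val + j.val + 1 = 2 then (1 : L) else 0)).Local v)))
    (γH : (UnitaryGroup.cmDatum L 2 (Matrix.of fun i j : Fin 2 => if i.val + j.val + 1 = 2 then (1 : L) else 0)).Local v ×
      (UnitaryGroup.cmDatum L 1 (Matrix.of fun i j : Fin 1 => if i.val + j.val + 1 = 1 then (1 : L) else 0)).Local v)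
    (hγ : IsLocalGRegular L v γH)
    [CompactSpace (Subgroup.centralizer ({γH.1} : Set ((UnitaryGroup.cmDatum L 2 (Matrix.of fun i j : Fin 2 => if i.val + j.val + 1 = 2 then (1 : L) else 0)).Local v)))] :
    classOrbitalIntegral mHv
        (fun g => (((νHv ((C.prod ⊤ : Subgroup ((UnitaryGroup.cmDatum L 2 (Matrix.of fun i j : Fin 2 => if i.val + j.val + 1 = 2 then (1 : L) else 0)).Local v ×
          (UnitaryGroup.cmDatum L 1 (Matrix.of fun i j : Fin 1 => if i.val + j.val + 1 = 1 then (1 : L) else 0)).Local v)))).toReal : ℂ))⁻¹ *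
          (((C.prod ⊤ : Subgroup ((UnitaryGroup.cmDatum L 2 (Matrix.of fun i j : Fin 2 => if i.val + j.val + 1 = 2 then (1 : L) else 0)).Local v ×
            (UnitaryGroup.cmDatum L 1 (Matrix.of fun i j : Fin 1 => if i.val + j.val + 1 = 1 then (1 : L) else 0)).Local v))) : Set _).indicator (fun _ => (1 : ℂ)) g)
        (ConjClasses.mk γH) =
      classOrbitalIntegral m₂
        (fun g => (((ν₂ C).toReal : ℂ))⁻¹ * (C : Set ((UnitaryGroup.cmDatum L 2 (Matrix.of fun i j : Fin 2 => if i.val + j.val + 1 = 2 then (1 : L) else 0)).Local v)).indicator (fun _ => (1 : ℂ)) g)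
        (ConjClasses.mk γH.1) := by
  rw [classOrbitalIntegral_smul_indicator_prod_top_eq_natCard_fixedBy L v νHv hns hcanH C hCo hCc γH hγ,
    classOrbitalIntegral_smul_indicator_complex_local_eq_natCard_fixedBy L 2 _ v ν₂ (UnitaryGroup.antidiagOne_isHermitian L 2)
      (UnitaryGroup.isUnit_antidiagOne_det L 2).ne_zero hcan₂ C hCo hCc γH.1 (isRegularElt_fst_snd_of_isLocalGRegular L v γH hγ).1]

end CM

end Summit.HodgeConjecture.HodgeConjecture.Cruxes.H413.F0P3cStCharTSEllMassHOrbEll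

end
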